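import Summits.BirchSwinnertonDyer.BirchSwinnertonDyer.Theorems.ByReductionTypeAtTwoFineSelmerConjAAtTwoAdditivePotGoodAscentStampsA
import HarnessLib

/-!
# C4″ `AdditivePotMultOverKAtTwo` (item stmt-BirchSwinnertonDyer-22618), the (I1M′) input of the upper half on the `Δ < 0` rows:
# KERNEL STAMPS, part A — UNCONDITIONAL statement (A) at `2` (ZERO hypotheses, ZERO named facts) for the four C4″ census curves whose
# `2`-torsion cubic field is already kernel-certified in the tree (`d = −104`: 462384v1, 82576c1, 82576g1; `d = −12936`: 310464lx1)

Cell `bsd-2adic`, rung K4, seat `bsd-2adic-k4-w3` GEN 11 (explicit unit of director-bsd g16 (309)(7); `--supports stmt-BirchSwinnertonDyer-22618`).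
HONEST FRAMING (D-0036/D-0054/D-0152): THEOREMS ONLY (no definition, no named fact, no `sorry`). Each `conjA_two_<L>'` is PROVED OUTRIGHT: Coates–Sujatha's
statement (A) at `p = 2` for ONE curve (the census cubic model `y² = x³ + a₂x² + a₄x + a₆` of the Cremona class, a-invariants from addL2x GEN 13's
`nst_census-j313647.tsv`), with no hypothesis and no named fact from print. This is statement (A), NOT BSD: BSD₂ for these curves is not proved by any of
this; C4″ and its (I1M′) binder (the `∀`-statements) stay research-open; nothing is booked; the pen's word stands (RC-490 (4): no row of 22618 changes tier
by numerics or by a row stamp).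

WHY THESE FOUR ROWS. GEN 9 (`hAnaMI_negDisc_of_cubicFieldMu`, `conjA_two_of_classicalMu_cubicField_of_Δ_neg`) keyed the (I1M′) input on the 269 `Δ < 0`
irreducible pot-mult rows to «`μ₂ = 0` along the cyclotomic `ℤ₂`-extensions of the cubic field `ℚ(x(T))`». eng-2's census of record
(`CERT-ADD-POTMULT-FUKUDA269-E2.md`, LAYERS table) prints the polredabs cubic of each row: the rows 462384v1 / 82576c1 / 82576g1 have the field of
`X³ − X − 2` (`d = −104`, `2 = 𝔭𝔮²`, `h = 1`) and 310464lx1 the field of `X³ − X² − 30X + 78` (`d = −12936`) — EXACTLY the `2`-torsion cubic fields of the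
C1″ rows 237952bv1 / 413952bm1, for which k4-w1 GEN 8 landed Iwasawa's `μ₂ = 0` in the kernel (`classicalMu_two_237952bv1`, `classicalMu_two_413952bm1`:
Chevalley's door at `2` — `e₁ = 0` from a `2`-adically certified non-norm unit — + even-index total-ramification certificate `n₀ = 0` + Minkowski class-number
certificate + Fukuda 1994 Thm. 1 (1)). So for these four C4″ rows the (I1M′) input is ALREADY a kernel theorem; this file only supplies the field
identification `ℚ(β) = ℚ(θ)` (`β` = a root of the curve's cubic written in the power basis of `θ`, and back) and applies cruxlead-19573-w2 GEN 7's door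
`TotallyComplexMu.conjA_two_cubicModel_of_classicalMu_of_discr_neg` (kernel Lim 3.5@2 + the `ℓ = 2` ascent with real places), exactly as k4-w1's
`…AscentStampsA` does for the C1″ rows. Pattern and tooling: k4-w1 GEN 5–8 (census currency); nothing here is new number theory.

References: [CoatesSujatha2005] Conj. A, Thm. 3.4; [Iwasawa1973MuInvariants] Thm. 2/3; [Fukuda1994] Thm. 1 (1); [Lang1990] Ch. 13 §4 Lemma 4.1;
[Lim2017FineSelmer] §3; tree p728213 (w2), k4-w1 `…MuTwoKernelRows{A,B}`, `…AscentStampsA`; cell files `eng2/fukuda269/LAYERS-ADD-POTMULT-FUKUDA269-E2-v1.tsv`,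
`addL2x/gen13/kit-nst/nst_census-j313647.tsv`, `k4w3/gen9/census/POTMULT-IRR-CONJA2-CENSUS-22618-k4w3-GEN9.tsv`.
-/

set_option autoImplicit false
-- sibling precedent (`…AscentStampsA.lean`): the directory name repeats the summit name
set_option linter.dupNamespace false

noncomputable section

open scoped Classical IntermediateField NumberField

namespace Summit.BirchSwinnertonDyer.BirchSwinnertonDyer.Theorems.AddKatoTwo

open WeierstrassCurve Field Polynomial IsDedekindDomain NumberField Matrix Literature.NumberTheory.EllipticCurves
  Literature.NumberTheory.GaloisRepresentations
  Literature.NumberTheory.IwasawaTheory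
  Summit.BirchSwinnertonDyer.BirchSwinnertonDyer.Theorems.SteinbergFibreAtTwo
  Summit.BirchSwinnertonDyer.BirchSwinnertonDyer.Theorems.AlignedTransportAtTwoTorsionPointField
  Summit.BirchSwinnertonDyer.BirchSwinnertonDyer.Theses.ByReductionTypeAtTwo

/-! ## Row `462384v1` — cubic field `d = −104` -/

/-- The census cubic model of the C4″ row `462384v1` (`y² = x³ + (0)x² + (-415951419)x + (-30328928356246)`, addL2x GEN 13 `nst_census` a-invariants) is an elliptic curve. -/
theorem isElliptic_462384v1' : (⟨0, ((0 : ℤ) : ℚ), 0, ((-415951419 : ℤ) : ℚ), ((-30328928356246 : ℤ) : ℚ)⟩ : WeierstrassCurve ℚ).IsElliptic :=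
  isElliptic_cubicModel _ _ _ (by simp only [Cubic.discr]; norm_num)

/-- **UNCONDITIONAL (A)₂ for the C4″ census curve `462384v1` — ZERO hypotheses, ZERO named facts** (additive potentially multiplicative at `2`,
irreducible `E[2]`, `Δ < 0`; `2`-torsion cubic field `ℚ(θ)`, `θ³ + (0)θ² + (-1)θ + (-2) = 0`, `d = -104`, two primes above `2` (`2 = 𝔭𝔮²`, `F_𝔮 = ℚ₂(√6)`), `h = 1`). Coates–Sujatha's
statement (A) at `p = 2` for the cubic model `y² = x³ + (0)x² + (-415951419)x + (-30328928356246)`: for every cyclotomic `ℤ₂`-extension of `ℚ` the dual fine Selmer group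
over `ℚ_∞` is finitely generated over `ℤ₂` (`∃ γ D` currency). KERNEL: k4-w1's `classicalMu_two_237952bv1` (μ₂(ℚ(θ)_cyc) = 0 for the field of `X³ − X − 2`: Chevalley door at `2` + even-index certificate + Fukuda) ⟹ cruxlead-19573-w2's `ℓ = 2` ascent to the totally complex
`ℚ(E[2]) = ℚ(θ, √d)` and kernel Lim 3.5@2 (`TotallyComplexMu.conjA_two_cubicModel_of_classicalMu_of_discr_neg`); the root `β = x(T)` of the curve's cubic is
`910 + (24882)θ + (-1365)θ²` and `ℚ(β) = ℚ(θ)`. This discharges the (I1M′) input of this row (GEN 9 `hAnaMI_negDisc_of_cubicFieldMu`) in the kernel;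
it is statement (A), NOT BSD: BSD₂ for `462384v1` is NOT proved by this. [cite: CoatesSujatha2005, Conj. A and Thm. 3.4]
[cite: Iwasawa1973MuInvariants, Thm. 2 and Thm. 3] [cite: Fukuda1994, Thm. 1 (1), p. 264] [cite: Lang1990, Ch. 13 §4, Lemma 4.1] -/
theorem conjA_two_462384v1' (κ : ZpExtension ℚ 2) (hκ : κ.IsCyclotomic) :
    haveI := isElliptic_462384v1'
    ∃ (γ : absoluteGaloisGroup ℚ) (D : (⟨0, ((0 : ℤ) : ℚ), 0, ((-415951419 : ℤ) : ℚ), ((-30328928356246 : ℤ) : ℚ)⟩ : WeierstrassCurve ℚ).FineSelmerDualData κ γ),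
      Module.Finite ℤ_[2] (RestrictScalars ℤ_[2] (IwasawaAlgebra 2) D.X) := by
  haveI := isElliptic_462384v1'
  obtain ⟨θ, hθ⟩ : ∃ θ : AlgebraicClosure ℚ, aeval θ (Cubic.toPoly ⟨1, ((0 : ℤ) : ℚ), ((-1 : ℤ) : ℚ), ((-2 : ℤ) : ℚ)⟩) = 0 :=
    IsAlgClosed.exists_aeval_eq_zero _ _ (by rw [Cubic.degree_of_a_ne_zero one_ne_zero]; norm_num)
  have hθ' : θ ^ 3 + (0 : AlgebraicClosure ℚ) * θ ^ 2 + (-1 : AlgebraicClosure ℚ) * θ + (-2 : AlgebraicClosure ℚ) = 0 := by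
    have := hθ
    simp only [Cubic.toPoly, map_one, one_mul, aeval_add, aeval_mul, aeval_C, aeval_X_pow, aeval_X,
      eq_ratCast, Rat.cast_intCast] at this
    push_cast at this
    linear_combination this
  set β : AlgebraicClosure ℚ := algebraMap ℚ (AlgebraicClosure ℚ) (910 : ℚ) +
      algebraMap ℚ (AlgebraicClosure ℚ) (24882 : ℚ) * θ + algebraMap ℚ (AlgebraicClosure ℚ) (-1365 : ℚ) * θ ^ 2 with hβdef
  have hβ : aeval β (Cubic.toPoly ⟨1, ((0 : ℤ) : ℚ), ((-415951419 : ℤ) : ℚ), ((-30328928356246 : ℤ) : ℚ)⟩) = 0 := by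
    simp only [Cubic.toPoly, map_one, one_mul, aeval_add, aeval_mul, aeval_C, aeval_X_pow, aeval_X, eq_ratCast,
      Rat.cast_intCast]
    rw [hβdef]
    simp only [eq_ratCast]
    push_cast
    linear_combination ((15353345288268 : AlgebraicClosure ℚ) + (-2532728216655 : AlgebraicClosure ℚ) * θ + (139082293350 : AlgebraicClosure ℚ) * θ ^ 2 + (-2543302125 : AlgebraicClosure ℚ) * θ ^ 3) * hθ'
  have hadj : IntermediateField.adjoin ℚ {β} = IntermediateField.adjoin ℚ {θ} := by
    apply le_antisymm
    · rw [IntermediateField.adjoin_simple_le_iff, hβdef]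
      have hθmem := IntermediateField.mem_adjoin_simple_self ℚ θ
      exact add_mem (add_mem (algebraMap_mem _ _) (mul_mem (algebraMap_mem _ _) hθmem))
        (mul_mem (algebraMap_mem _ _) (pow_mem hθmem 2))
    · rw [IntermediateField.adjoin_simple_le_iff]
      have hθeq : θ = algebraMap ℚ (AlgebraicClosure ℚ) (-2208815/89653248 : ℚ) +
          algebraMap ℚ (AlgebraicClosure ℚ) (93839/2330984448 : ℚ) * β +
          algebraMap ℚ (AlgebraicClosure ℚ) (35/393936371712 : ℚ) * β ^ 2 := by
        rw [hβdef]; simp only [eq_ratCast]; push_cast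
        linear_combination (((390775 : AlgebraicClosure ℚ) / 64749568) + ((-42875 : AlgebraicClosure ℚ) / 258998272) * θ) * hθ'
      rw [hθeq]
      have hβmem := IntermediateField.mem_adjoin_simple_self ℚ β
      exact add_mem (add_mem (algebraMap_mem _ _) (mul_mem (algebraMap_mem _ _) hβmem))
        (mul_mem (algebraMap_mem _ _) (pow_mem hβmem 2))
  have h3 : Module.finrank ℚ (IntermediateField.adjoin ℚ {β}) = 3 := by
    rw [hadj]; exact finrank_adjoin_eq_three_of_irreducible irreducible_cubic_d104n hθ
  exact TotallyComplexMu.conjA_two_cubicModel_of_classicalMu_of_discr_neg (0) (-415951419) (-30328928356246)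
    (irreducible_cubic_of_finrank_adjoin_eq_three hβ h3) (by simp only [Cubic.discr]; norm_num) hβ
    (by rw [hadj]; exact classicalMu_two_237952bv1 hθ) κ hκ

/-! ## Row `82576c1` — cubic field `d = −104` -/

/-- The census cubic model of the C4″ row `82576c1` (`y² = x³ + (0)x² + (6517949)x + (2852886338)`, addL2x GEN 13 `nst_census` a-invariants) is an elliptic curve. -/
theorem isElliptic_82576c1' : (⟨0, ((0 : ℤ) : ℚ), 0, ((6517949 : ℤ) : ℚ), ((2852886338 : ℤ) : ℚ)⟩ : WeierstrassCurve ℚ).IsElliptic :=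
  isElliptic_cubicModel _ _ _ (by simp only [Cubic.discr]; norm_num)

/-- **UNCONDITIONAL (A)₂ for the C4″ census curve `82576c1` — ZERO hypotheses, ZERO named facts** (additive potentially multiplicative at `2`,
irreducible `E[2]`, `Δ < 0`; `2`-torsion cubic field `ℚ(θ)`, `θ³ + (0)θ² + (-1)θ + (-2) = 0`, `d = -104`, two primes above `2` (`2 = 𝔭𝔮²`, `F_𝔮 = ℚ₂(√6)`), `h = 1`). Coates–Sujatha's
statement (A) at `p = 2` for the cubic model `y² = x³ + (0)x² + (6517949)x + (2852886338)`: for every cyclotomic `ℤ₂`-extension of `ℚ` the dual fine Selmer group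
over `ℚ_∞` is finitely generated over `ℤ₂` (`∃ γ D` currency). KERNEL: k4-w1's `classicalMu_two_237952bv1` (μ₂(ℚ(θ)_cyc) = 0 for the field of `X³ − X − 2`: Chevalley door at `2` + even-index certificate + Fukuda) ⟹ cruxlead-19573-w2's `ℓ = 2` ascent to the totally complex
`ℚ(E[2]) = ℚ(θ, √d)` and kernel Lim 3.5@2 (`TotallyComplexMu.conjA_two_cubicModel_of_classicalMu_of_discr_neg`); the root `β = x(T)` of the curve's cubic is
`-698 + (-1414)θ + (1047)θ²` and `ℚ(β) = ℚ(θ)`. This discharges the (I1M′) input of this row (GEN 9 `hAnaMI_negDisc_of_cubicFieldMu`) in the kernel;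
it is statement (A), NOT BSD: BSD₂ for `82576c1` is NOT proved by this. [cite: CoatesSujatha2005, Conj. A and Thm. 3.4]
[cite: Iwasawa1973MuInvariants, Thm. 2 and Thm. 3] [cite: Fukuda1994, Thm. 1 (1), p. 264] [cite: Lang1990, Ch. 13 §4, Lemma 4.1] -/
theorem conjA_two_82576c1' (κ : ZpExtension ℚ 2) (hκ : κ.IsCyclotomic) :
    haveI := isElliptic_82576c1'
    ∃ (γ : absoluteGaloisGroup ℚ) (D : (⟨0, ((0 : ℤ) : ℚ), 0, ((6517949 : ℤ) : ℚ), ((2852886338 : ℤ) : ℚ)⟩ : WeierstrassCurve ℚ).FineSelmerDualData κ γ),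
      Module.Finite ℤ_[2] (RestrictScalars ℤ_[2] (IwasawaAlgebra 2) D.X) := by
  haveI := isElliptic_82576c1'
  obtain ⟨θ, hθ⟩ : ∃ θ : AlgebraicClosure ℚ, aeval θ (Cubic.toPoly ⟨1, ((0 : ℤ) : ℚ), ((-1 : ℤ) : ℚ), ((-2 : ℤ) : ℚ)⟩) = 0 :=
    IsAlgClosed.exists_aeval_eq_zero _ _ (by rw [Cubic.degree_of_a_ne_zero one_ne_zero]; norm_num)
  have hθ' : θ ^ 3 + (0 : AlgebraicClosure ℚ) * θ ^ 2 + (-1 : AlgebraicClosure ℚ) * θ + (-2 : AlgebraicClosure ℚ) = 0 := by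
    have := hθ
    simp only [Cubic.toPoly, map_one, one_mul, aeval_add, aeval_mul, aeval_C, aeval_X_pow, aeval_X,
      eq_ratCast, Rat.cast_intCast] at this
    push_cast at this
    linear_combination this
  set β : AlgebraicClosure ℚ := algebraMap ℚ (AlgebraicClosure ℚ) (-698 : ℚ) +
      algebraMap ℚ (AlgebraicClosure ℚ) (-1414 : ℚ) * θ + algebraMap ℚ (AlgebraicClosure ℚ) (1047 : ℚ) * θ ^ 2 with hβdef
  have hβ : aeval β (Cubic.toPoly ⟨1, ((0 : ℤ) : ℚ), ((6517949 : ℤ) : ℚ), ((2852886338 : ℤ) : ℚ)⟩) = 0 := by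
    simp only [Cubic.toPoly, map_one, one_mul, aeval_add, aeval_mul, aeval_C, aeval_X_pow, aeval_X, eq_ratCast,
      Rat.cast_intCast]
    rw [hβdef]
    simp only [eq_ratCast]
    push_cast
    linear_combination ((1018355228 : AlgebraicClosure ℚ) + (5132372013 : AlgebraicClosure ℚ) * θ + (-4650118578 : AlgebraicClosure ℚ) * θ ^ 2 + (1147730823 : AlgebraicClosure ℚ) * θ ^ 3) * hθ'
  have hadj : IntermediateField.adjoin ℚ {β} = IntermediateField.adjoin ℚ {θ} := by
    apply le_antisymm
    · rw [IntermediateField.adjoin_simple_le_iff, hβdef]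
      have hθmem := IntermediateField.mem_adjoin_simple_self ℚ θ
      exact add_mem (add_mem (algebraMap_mem _ _) (mul_mem (algebraMap_mem _ _) hθmem))
        (mul_mem (algebraMap_mem _ _) (pow_mem hθmem 2))
    · rw [IntermediateField.adjoin_simple_le_iff]
      have hθeq : θ = algebraMap ℚ (AlgebraicClosure ℚ) (2274764201/1786284032 : ℚ) +
          algebraMap ℚ (AlgebraicClosure ℚ) (-1633993/3572568064 : ℚ) * β +
          algebraMap ℚ (AlgebraicClosure ℚ) (1047/3572568064 : ℚ) * β ^ 2 := by
        rw [hβdef]; simp only [eq_ratCast]; push_cast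
        linear_combination (((775019763 : AlgebraicClosure ℚ) / 893142016) + ((-1147730823 : AlgebraicClosure ℚ) / 3572568064) * θ) * hθ'
      rw [hθeq]
      have hβmem := IntermediateField.mem_adjoin_simple_self ℚ β
      exact add_mem (add_mem (algebraMap_mem _ _) (mul_mem (algebraMap_mem _ _) hβmem))
        (mul_mem (algebraMap_mem _ _) (pow_mem hβmem 2))
  have h3 : Module.finrank ℚ (IntermediateField.adjoin ℚ {β}) = 3 := by
    rw [hadj]; exact finrank_adjoin_eq_three_of_irreducible irreducible_cubic_d104n hθ
  exact TotallyComplexMu.conjA_two_cubicModel_of_classicalMu_of_discr_neg (0) (6517949) (2852886338)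
    (irreducible_cubic_of_finrank_adjoin_eq_three hβ h3) (by simp only [Cubic.discr]; norm_num) hβ
    (by rw [hadj]; exact classicalMu_two_237952bv1 hθ) κ hκ

/-! ## Row `82576g1` — cubic field `d = −104` -/

/-- The census cubic model of the C4″ row `82576g1` (`y² = x³ + (-1)x² + (-91207784)x + (-335240583824)`, addL2x GEN 13 `nst_census` a-invariants) is an elliptic curve. -/
theorem isElliptic_82576g1' : (⟨0, ((-1 : ℤ) : ℚ), 0, ((-91207784 : ℤ) : ℚ), ((-335240583824 : ℤ) : ℚ)⟩ : WeierstrassCurve ℚ).IsElliptic :=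
  isElliptic_cubicModel _ _ _ (by simp only [Cubic.discr]; norm_num)

/-- **UNCONDITIONAL (A)₂ for the C4″ census curve `82576g1` — ZERO hypotheses, ZERO named facts** (additive potentially multiplicative at `2`,
irreducible `E[2]`, `Δ < 0`; `2`-torsion cubic field `ℚ(θ)`, `θ³ + (0)θ² + (-1)θ + (-2) = 0`, `d = -104`, two primes above `2` (`2 = 𝔭𝔮²`, `F_𝔮 = ℚ₂(√6)`), `h = 1`). Coates–Sujatha's
statement (A) at `p = 2` for the cubic model `y² = x³ + (-1)x² + (-91207784)x + (-335240583824)`: for every cyclotomic `ℤ₂`-extension of `ℚ` the dual fine Selmer group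
over `ℚ_∞` is finitely generated over `ℤ₂` (`∃ γ D` currency). KERNEL: k4-w1's `classicalMu_two_237952bv1` (μ₂(ℚ(θ)_cyc) = 0 for the field of `X³ − X − 2`: Chevalley door at `2` + even-index certificate + Fukuda) ⟹ cruxlead-19573-w2's `ℓ = 2` ascent to the totally complex
`ℚ(E[2]) = ℚ(θ, √d)` and kernel Lim 3.5@2 (`TotallyComplexMu.conjA_two_cubicModel_of_classicalMu_of_discr_neg`); the root `β = x(T)` of the curve's cubic is
`-1855 + (4234)θ + (2783)θ²` and `ℚ(β) = ℚ(θ)`. This discharges the (I1M′) input of this row (GEN 9 `hAnaMI_negDisc_of_cubicFieldMu`) in the kernel;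
it is statement (A), NOT BSD: BSD₂ for `82576g1` is NOT proved by this. [cite: CoatesSujatha2005, Conj. A and Thm. 3.4]
[cite: Iwasawa1973MuInvariants, Thm. 2 and Thm. 3] [cite: Fukuda1994, Thm. 1 (1), p. 264] [cite: Lang1990, Ch. 13 §4, Lemma 4.1] -/
theorem conjA_two_82576g1' (κ : ZpExtension ℚ 2) (hκ : κ.IsCyclotomic) :
    haveI := isElliptic_82576g1'
    ∃ (γ : absoluteGaloisGroup ℚ) (D : (⟨0, ((-1 : ℤ) : ℚ), 0, ((-91207784 : ℤ) : ℚ), ((-335240583824 : ℤ) : ℚ)⟩ : WeierstrassCurve ℚ).FineSelmerDualData κ γ),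
      Module.Finite ℤ_[2] (RestrictScalars ℤ_[2] (IwasawaAlgebra 2) D.X) := by
  haveI := isElliptic_82576g1'
  obtain ⟨θ, hθ⟩ : ∃ θ : AlgebraicClosure ℚ, aeval θ (Cubic.toPoly ⟨1, ((0 : ℤ) : ℚ), ((-1 : ℤ) : ℚ), ((-2 : ℤ) : ℚ)⟩) = 0 :=
    IsAlgClosed.exists_aeval_eq_zero _ _ (by rw [Cubic.degree_of_a_ne_zero one_ne_zero]; norm_num)
  have hθ' : θ ^ 3 + (0 : AlgebraicClosure ℚ) * θ ^ 2 + (-1 : AlgebraicClosure ℚ) * θ + (-2 : AlgebraicClosure ℚ) = 0 := by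
    have := hθ
    simp only [Cubic.toPoly, map_one, one_mul, aeval_add, aeval_mul, aeval_C, aeval_X_pow, aeval_X,
      eq_ratCast, Rat.cast_intCast] at this
    push_cast at this
    linear_combination this
  set β : AlgebraicClosure ℚ := algebraMap ℚ (AlgebraicClosure ℚ) (-1855 : ℚ) +
      algebraMap ℚ (AlgebraicClosure ℚ) (4234 : ℚ) * θ + algebraMap ℚ (AlgebraicClosure ℚ) (2783 : ℚ) * θ ^ 2 with hβdef
  have hβ : aeval β (Cubic.toPoly ⟨1, ((-1 : ℤ) : ℚ), ((-91207784 : ℤ) : ℚ), ((-335240583824 : ℤ) : ℚ)⟩) = 0 := by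
    simp only [Cubic.toPoly, map_one, one_mul, aeval_add, aeval_mul, aeval_C, aeval_X_pow, aeval_X, eq_ratCast,
      Rat.cast_intCast]
    rw [hβdef]
    simp only [eq_ratCast]
    push_cast
    linear_combination ((86218343452 : AlgebraicClosure ℚ) + (128115903157 : AlgebraicClosure ℚ) * θ + (98378120478 : AlgebraicClosure ℚ) * θ ^ 2 + (21554582687 : AlgebraicClosure ℚ) * θ ^ 3) * hθ'
  have hadj : IntermediateField.adjoin ℚ {β} = IntermediateField.adjoin ℚ {θ} := by
    apply le_antisymm
    · rw [IntermediateField.adjoin_simple_le_iff, hβdef]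
      have hθmem := IntermediateField.mem_adjoin_simple_self ℚ θ
      exact add_mem (add_mem (algebraMap_mem _ _) (mul_mem (algebraMap_mem _ _) hθmem))
        (mul_mem (algebraMap_mem _ _) (pow_mem hθmem 2))
    · rw [IntermediateField.adjoin_simple_le_iff]
      have hθeq : θ = algebraMap ℚ (AlgebraicClosure ℚ) (42303931801/3176 : ℚ) +
          algebraMap ℚ (AlgebraicClosure ℚ) (15346915/12704 : ℚ) * β +
          algebraMap ℚ (AlgebraicClosure ℚ) (-2783/12704 : ℚ) * β ^ 2 := by
        rw [hβdef]; simp only [eq_ratCast]; push_cast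
        linear_combination (((16396353413 : AlgebraicClosure ℚ) / 3176) + ((21554582687 : AlgebraicClosure ℚ) / 12704) * θ) * hθ'
      rw [hθeq]
      have hβmem := IntermediateField.mem_adjoin_simple_self ℚ β
      exact add_mem (add_mem (algebraMap_mem _ _) (mul_mem (algebraMap_mem _ _) hβmem))
        (mul_mem (algebraMap_mem _ _) (pow_mem hβmem 2))
  have h3 : Module.finrank ℚ (IntermediateField.adjoin ℚ {β}) = 3 := by
    rw [hadj]; exact finrank_adjoin_eq_three_of_irreducible irreducible_cubic_d104n hθ
  exact TotallyComplexMu.conjA_two_cubicModel_of_classicalMu_of_discr_neg (-1) (-91207784) (-335240583824)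
    (irreducible_cubic_of_finrank_adjoin_eq_three hβ h3) (by simp only [Cubic.discr]; norm_num) hβ
    (by rw [hadj]; exact classicalMu_two_237952bv1 hθ) κ hκ

/-! ## Row `310464lx1` — cubic field `d = −12936` -/

/-- The census cubic model of the C4″ row `310464lx1` (`y² = x³ + (0)x² + (-18633132)x + (-31356560592)`, addL2x GEN 13 `nst_census` a-invariants) is an elliptic curve. -/
theorem isElliptic_310464lx1' : (⟨0, ((0 : ℤ) : ℚ), 0, ((-18633132 : ℤ) : ℚ), ((-31356560592 : ℤ) : ℚ)⟩ : WeierstrassCurve ℚ).IsElliptic :=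
  isElliptic_cubicModel _ _ _ (by simp only [Cubic.discr]; norm_num)

/-- **UNCONDITIONAL (A)₂ for the C4″ census curve `310464lx1` — ZERO hypotheses, ZERO named facts** (additive potentially multiplicative at `2`,
irreducible `E[2]`, `Δ < 0`; `2`-torsion cubic field `ℚ(θ)`, `θ³ + (-1)θ² + (-30)θ + (78) = 0`, `d = -12936`, two primes above `2` (`2 = 𝔭𝔮²`), `h = 3`). Coates–Sujatha's
statement (A) at `p = 2` for the cubic model `y² = x³ + (0)x² + (-18633132)x + (-31356560592)`: for every cyclotomic `ℤ₂`-extension of `ℚ` the dual fine Selmer group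
over `ℚ_∞` is finitely generated over `ℤ₂` (`∃ γ D` currency). KERNEL: k4-w1's `classicalMu_two_413952bm1` (μ₂(ℚ(θ)_cyc) = 0 for the field of `X³ − X² − 30X + 78`: Chevalley door at `2` + even-index certificate + Fukuda) ⟹ cruxlead-19573-w2's `ℓ = 2` ascent to the totally complex
`ℚ(E[2]) = ℚ(θ, √d)` and kernel Lim 3.5@2 (`TotallyComplexMu.conjA_two_cubicModel_of_classicalMu_of_discr_neg`); the root `β = x(T)` of the curve's cubic is
`-630 + (-672)θ + (42)θ²` and `ℚ(β) = ℚ(θ)`. This discharges the (I1M′) input of this row (GEN 9 `hAnaMI_negDisc_of_cubicFieldMu`) in the kernel;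
it is statement (A), NOT BSD: BSD₂ for `310464lx1` is NOT proved by this. [cite: CoatesSujatha2005, Conj. A and Thm. 3.4]
[cite: Iwasawa1973MuInvariants, Thm. 2 and Thm. 3] [cite: Fukuda1994, Thm. 1 (1), p. 264] [cite: Lang1990, Ch. 13 §4, Lemma 4.1] -/
theorem conjA_two_310464lx1' (κ : ZpExtension ℚ 2) (hκ : κ.IsCyclotomic) :
    haveI := isElliptic_310464lx1'
    ∃ (γ : absoluteGaloisGroup ℚ) (D : (⟨0, ((0 : ℤ) : ℚ), 0, ((-18633132 : ℤ) : ℚ), ((-31356560592 : ℤ) : ℚ)⟩ : WeierstrassCurve ℚ).FineSelmerDualData κ γ),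
      Module.Finite ℤ_[2] (RestrictScalars ℤ_[2] (IwasawaAlgebra 2) D.X) := by
  haveI := isElliptic_310464lx1'
  obtain ⟨θ, hθ⟩ : ∃ θ : AlgebraicClosure ℚ, aeval θ (Cubic.toPoly ⟨1, ((-1 : ℤ) : ℚ), ((-30 : ℤ) : ℚ), ((78 : ℤ) : ℚ)⟩) = 0 :=
    IsAlgClosed.exists_aeval_eq_zero _ _ (by rw [Cubic.degree_of_a_ne_zero one_ne_zero]; norm_num)
  have hθ' : θ ^ 3 + (-1 : AlgebraicClosure ℚ) * θ ^ 2 + (-30 : AlgebraicClosure ℚ) * θ + (78 : AlgebraicClosure ℚ) = 0 := by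
    have := hθ
    simp only [Cubic.toPoly, map_one, one_mul, aeval_add, aeval_mul, aeval_C, aeval_X_pow, aeval_X,
      eq_ratCast, Rat.cast_intCast] at this
    push_cast at this
    linear_combination this
  set β : AlgebraicClosure ℚ := algebraMap ℚ (AlgebraicClosure ℚ) (-630 : ℚ) +
      algebraMap ℚ (AlgebraicClosure ℚ) (-672 : ℚ) * θ + algebraMap ℚ (AlgebraicClosure ℚ) (42 : ℚ) * θ ^ 2 with hβdef
  have hβ : aeval β (Cubic.toPoly ⟨1, ((0 : ℤ) : ℚ), ((-18633132 : ℤ) : ℚ), ((-31356560592 : ℤ) : ℚ)⟩) = 0 := by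
    simp only [Cubic.toPoly, map_one, one_mul, aeval_add, aeval_mul, aeval_C, aeval_X_pow, aeval_X, eq_ratCast,
      Rat.cast_intCast]
    rw [hβdef]
    simp only [eq_ratCast]
    push_cast
    linear_combination ((-254714544 : AlgebraicClosure ℚ) + (52306128 : AlgebraicClosure ℚ) * θ + (-3482136 : AlgebraicClosure ℚ) * θ ^ 2 + (74088 : AlgebraicClosure ℚ) * θ ^ 3) * hθ'
  have hadj : IntermediateField.adjoin ℚ {β} = IntermediateField.adjoin ℚ {θ} := by
    apply le_antisymm
    · rw [IntermediateField.adjoin_simple_le_iff, hβdef]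
      have hθmem := IntermediateField.mem_adjoin_simple_self ℚ θ
      exact add_mem (add_mem (algebraMap_mem _ _) (mul_mem (algebraMap_mem _ _) hθmem))
        (mul_mem (algebraMap_mem _ _) (pow_mem hθmem 2))
    · rw [IntermediateField.adjoin_simple_le_iff]
      have hθeq : θ = algebraMap ℚ (AlgebraicClosure ℚ) (-1003/512 : ℚ) +
          algebraMap ℚ (AlgebraicClosure ℚ) (-25/14336 : ℚ) * β +
          algebraMap ℚ (AlgebraicClosure ℚ) (1/5419008 : ℚ) * β ^ 2 := by
        rw [hβdef]; simp only [eq_ratCast]; push_cast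
        linear_combination (((31 : AlgebraicClosure ℚ) / 3072) + ((-1 : AlgebraicClosure ℚ) / 3072) * θ) * hθ'
      rw [hθeq]
      have hβmem := IntermediateField.mem_adjoin_simple_self ℚ β
      exact add_mem (add_mem (algebraMap_mem _ _) (mul_mem (algebraMap_mem _ _) hβmem))
        (mul_mem (algebraMap_mem _ _) (pow_mem hβmem 2))
  have h3 : Module.finrank ℚ (IntermediateField.adjoin ℚ {β}) = 3 := by
    rw [hadj]; exact finrank_adjoin_eq_three_of_irreducible irreducible_cubic_d12936n hθ
  exact TotallyComplexMu.conjA_two_cubicModel_of_classicalMu_of_discr_neg (0) (-18633132) (-31356560592)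
    (irreducible_cubic_of_finrank_adjoin_eq_three hβ h3) (by simp only [Cubic.discr]; norm_num) hβ
    (by rw [hadj]; exact classicalMu_two_413952bm1 hθ) κ hκ
end Summit.BirchSwinnertonDyer.BirchSwinnertonDyer.Theorems.AddKatoTwo

end
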